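import Summits.QuantumFields.YangMills.Theses.BalabanUVNodes
import Summits.QuantumFields.YangMills.Theorems.BalabanUVNodesN27AtRecord13CoPHKeyedCore
import Summits.QuantumFields.YangMills.Theorems.BalabanUVNodesN21DilationRoadAtRecord13CoPH

/-!
# BalabanUVNodes ∕ N27 = binder B5 AT THE RECORD, leaf E — K3⁷ `Theses.BalabanUVNodes.SpineGivenEndpointR13SepCoPH` FROM THE KEYED FACES
# WITH THE N21 FACE `h21` SUPPLIED BY THE DILATION ROAD: leaf D `spineGivenEndpointR13SepCoPH_of_keyedFacesP` ∕ `_of_keyedCore` ∕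
# `_of_keyedFacesRatesHolder`'s binder `h21` REPLACED by n21-w2's per-tuple dilation package with domination
# (`N21DilationRoadAtRecord13CoPH.shellWeightBound_guarded₁₃CoPH_of_dilationLevels` BY NAME at the item's guard)

Track A of `YM-PLAN.md` (cell `pub-ymgap`, HUMAN RULING D-0062 ∕ D-0149 width seats), node **N21** feeding binder B5 = **N27**; WIDTH SEAT
`pub-ymgap-dag-n21-w2` (gen 0), W-SEAT-START-LIST v3 §n21 ITEM 2 «`KeyedShellWeight cr` (leaf D's `h21`) AT THE RECORD … the KNIT at the
record», file 3.  THEOREMS ONLY: 0 `def`, 0 `sorry`, standard axioms; COUNT-NEUTRAL; `--kind proof --supports stmt-QuantumFields-20544 --as helper`.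
A fifth route-facing leaf in dag-n27-c's sense (leaf A ∕ B ∕ C ∕ D are terminal and topic-scoped; nothing imports them and nothing may import
this file): imports the Theses file (the item BY NAME), dag-n27-c's `N`-generic guarded composer `…N27AtRecord13CoPHKeyedCore`
(`keyedGuarded₁₃CoPH_of_keyedFacesP` ∕ `_of_keyedCore` ∕ `_of_keyedFacesRatesHolder`) and n21-w2's file 1 `…N21DilationRoadAtRecord13CoPH`.
Restates nothing; cites by name; leaf D is NOT imported (its move `fun F θ hP hG hθ _ _ ↦ keyedGuarded₁₃CoPH_… F θ hP.toCore hG hθ` is repeated).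

WHAT IS KERNEL-CHECKED ([bookkeeping]; readings `cr` ∕ `rr` off `(θ, hc : Provisos₁₃CoPH)` as in leaf A §2 ∕ leaf D, PARAMETERS; `N = 2`).
* `spineGivenEndpointR13SepCoPH_of_keyedFacesP_dilationLevels` — THE ITEM from N20 at `cr`, THE DILATION ROAD's per-tuple package with
  domination at `cr` (file 1 §3's `hread`, guard `θ.ZhUnity F 2 ∧ θ.SlotsNondegenerate₁₃ F 2`) IN PLACE OF `h21`, the rates at an ARBITRARY
  predicate `P`, the N19′ edge reading `P`, and the keyed extraction clause.
* `spineGivenEndpointR13SepCoPH_of_keyedCore_dilationLevels` — the same with NO rates binder (the UNCONDITIONAL same-tuple ∃δ-core edge).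
* `spineGivenEndpointR13SepCoPH_of_keyedFacesRatesHolder_dilationLevels` — the same in the plan's R-β currency, BUNDLED
  (`RatesHolderAt (datumOfRecord₁₃CoPH F 2 θ h) (rr …) β`, dag-n16-e 41ᴴ; the K3⁷ skeleton v2's concluder shape).

HONEST FRAMING.  NOT a discharge: terms of the item's type under displayed hypotheses (audit `proof.conditional`), every one inhabited for
no family today (K0⁷ OPEN); the dilation package's `LevelLedger`s ((M1) per level — NOT PRINTED — + [dict]), `LiveWindow`s and letters are
HYPOTHESES (NODE O's term object); NE3 at exponent β, NE7 ∕ NE7b ∕ NE7c NOT PROVED; nothing of Bałaban's asserted or instantiated; N21 NOT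
discharged, N27 COMPOSITE, NOT discharged; K3⁷ NOT claimed closed; route rev 25 and the skeleton of record UNTOUCHED (additive file); counts
UNMOVED (typed 28∕28 · discharged 5∕27); one finite four-torus programme at fixed `ε` — NOT ℝ⁴, NOT infinite volume, NOT OS, NOT a mass gap,
NOT Clay.  No decl below carries a cite tag.
-/

set_option autoImplicit false

open Finset

namespace Summit.QuantumFields.YangMills.Theorems.N21DilationRoadAtRecord13CoPH

open Literature.MathematicalPhysics.QuantumFieldTheory.Balaban1983to89
open Literature.MathematicalPhysics.QuantumFieldTheory.Balaban1983to89.T4Continuum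
open T4WeightBudget (RelWeightBound)
open T4IndicatorShell (ShellWeightBound)
open T4ShellMeasureLevels (LevelLedger LiveWindow)
open T4ContinuumYM4Torus (ForSmallCouplings)
open Summit.QuantumFields.BalabanUV.T4Continuum.Spine
open Summit.QuantumFields.YangMills.Theses.BalabanUVNodes (SpineGivenEndpointR13SepCoPH)
open YMDAG.UVSplit
open Node00 (Stage13HParams datumOfRecord₁₃CoPH)
open Summit.QuantumFields.YangMills.BalabanUVNodes.SpineRatesHolder (RatesHolderAt)
open BalabanUVNodesN27SpineRecord (keyedGuarded₁₃CoPH_of_keyedFacesP keyedGuarded₁₃CoPH_of_keyedCore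
  keyedGuarded₁₃CoPH_of_keyedFacesRatesHolder)

variable (cr : (F : T4Family) → (θ : Stage13HParams F 2) → θ.Provisos₁₃CoPH F 2 → (ℕ → ℝ) → List (ULoop F) → SpineCarriers)
  (rr : (F : T4Family) → (θ : Stage13HParams F 2) → θ.Provisos₁₃CoPH F 2 → (ℕ → ℝ) → List (ULoop F) → RateCarriers 2)
  (P : ∀ {F : T4Family}, Datum F 2 → RateCarriers 2 → Prop) (β : ℝ)

/-- ★★ **K3⁷ FROM THE KEYED FACES AT AN ARBITRARY RATES PREDICATE `P`, THE N21 FACE FROM THE DILATION ROAD** (`N = 2`): leaf D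
`spineGivenEndpointR13SepCoPH_of_keyedFacesP` with `h21` REPLACED by file 1 §3's per-tuple dilation package with domination at the guard
`θ.ZhUnity F 2 ∧ θ.SlotsNondegenerate₁₃ F 2` (`shellWeightBound_guarded₁₃CoPH_of_dilationLevels` BY NAME).  NOT a discharge. [bookkeeping] -/
theorem spineGivenEndpointR13SepCoPH_of_keyedFacesP_dilationLevels
    (h20 : ∀ (F : T4Family) (θ : Stage13HParams F 2) (hP : θ.Provisos₁₃CoPH F 2), (θ.ZhUnity F 2 ∧ θ.SlotsNondegenerate₁₃ F 2) → θ.Admissible F 2 → ∀ (g₀ : ℕ → ℝ) (os : List (ULoop F)),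
      RelWeightBound (cr F θ hP g₀ os).l₀ (cr F θ hP g₀ os).T (cr F θ hP g₀ os).A (cr F θ hP g₀ os).B (cr F θ hP g₀ os).Bad (cr F θ hP g₀ os).W)
    (h21dil : ∀ (F : T4Family) (θ : Stage13HParams F 2) (hP : θ.Provisos₁₃CoPH F 2), (θ.ZhUnity F 2 ∧ θ.SlotsNondegenerate₁₃ F 2) → θ.Admissible F 2 →
      ∀ (g₀ : ℕ → ℝ) (os : List (ULoop F)), letI S := cr F θ hP g₀ os
      Summable S.Wsh ∧
      ∃ (σA σB : Type) (SA : ℕ → Finset σA) (SB : ℕ → Finset σB) (pieceA : ℕ → ℝ → σA → S.ι → ℝ)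
        (pieceB : ℕ → ℝ → σB → S.ι → ℝ) (lvlA : ℕ → σA → ℕ) (lvlB : ℕ → σB → ℕ) (MA dA ρA MB dB ρB : ℕ → ℝ)
        (N₁ : ℕ) (νbar Mbar d₀ c₁ ϑ : ℝ) (p q : ℕ),
        LevelLedger S.l₀ S.T S.A S.shA SA pieceA lvlA (fun j => MA j * (3 * (dA j + 1) / (1 - ρA j))) ρA ∧
        LevelLedger S.l₀ S.T S.B S.shB SB pieceB lvlB (fun j => MB j * (3 * (dB j + 1) / (1 - ρB j))) ρB ∧
        LiveWindow SA lvlA N₁ νbar ∧ LiveWindow SB lvlB N₁ νbar ∧ 0 ≤ ϑ ∧ ϑ < 1 ∧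
        (∀ j, 0 ≤ MA j) ∧ (∀ j, MA j ≤ Mbar * ((j : ℝ) ^ q + 1)) ∧ (∀ j, 0 ≤ MB j) ∧ (∀ j, MB j ≤ Mbar * ((j : ℝ) ^ q + 1)) ∧
        (∀ j, 0 ≤ dA j) ∧ (∀ j, dA j ≤ d₀ * ((j : ℝ) ^ p + 1)) ∧ (∀ j, 0 ≤ dB j) ∧ (∀ j, dB j ≤ d₀ * ((j : ℝ) ^ p + 1)) ∧
        (∀ j, ρA j ≤ 1 / 2) ∧ (∀ j, ρA j ≤ c₁ * ϑ ^ j) ∧ (∀ j, ρB j ≤ 1 / 2) ∧ (∀ j, ρB j ≤ c₁ * ϑ ^ j) ∧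
        (∀ K, ∑ s ∈ SA K, (MA (lvlA K s) * (3 * (dA (lvlA K s) + 1) / (1 - ρA (lvlA K s)))) * ρA (lvlA K s) +
          ∑ s ∈ SB K, (MB (lvlB K s) * (3 * (dB (lvlB K s) + 1) / (1 - ρB (lvlB K s)))) * ρB (lvlB K s) ≤ S.Wsh K))
    (hrates : ∀ (F : T4Family) (θ : Stage13HParams F 2) (hP : θ.Provisos₁₃CoPH F 2), (θ.ZhUnity F 2 ∧ θ.SlotsNondegenerate₁₃ F 2) → θ.Admissible F 2 → ∀ (g₀ : ℕ → ℝ) (os : List (ULoop F)),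
      P (datumOfRecord₁₃CoPH F 2 θ hP) (rr F θ hP g₀ os))
    (h19 : ∀ (F : T4Family) (θ : Stage13HParams F 2) (hP : θ.Provisos₁₃CoPH F 2), (θ.ZhUnity F 2 ∧ θ.SlotsNondegenerate₁₃ F 2) → θ.Admissible F 2 → ∀ (g₀ : ℕ → ℝ) (os : List (ULoop F)),
      P (datumOfRecord₁₃CoPH F 2 θ hP) (rr F θ hP g₀ os) → letI := (cr F θ hP g₀ os).dec
        ∃ δ : ℕ → ℝ, NE7.Core (cr F θ hP g₀ os).l₀ (cr F θ hP g₀ os).vol (cr F θ hP g₀ os).T (cr F θ hP g₀ os).Bad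
          (fun K t τ => (cr F θ hP g₀ os).A K t τ - (cr F θ hP g₀ os).shA K t τ) (fun K t τ => (cr F θ hP g₀ os).B K t τ - (cr F θ hP g₀ os).shB K t τ) δ ∧
          Summable δ)
    (hx : ∀ (F : T4Family) (θ : Stage13HParams F 2) (hP : θ.Provisos₁₃CoPH F 2), (θ.ZhUnity F 2 ∧ θ.SlotsNondegenerate₁₃ F 2) → θ.Admissible F 2 →
      B16.EndStatementBPrinted (datumOfRecord₁₃CoPH F 2 θ hP).C → DagBinding.EndpointExistence (datumOfRecord₁₃CoPH F 2 θ hP).C.toB12 →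
        ForSmallCouplings (datumOfRecord₁₃CoPH F 2 θ hP) fun g₀ => ∀ os : List (ULoop F),
          0 < (cr F θ hP g₀ os).l₀ ∧ 0 < (cr F θ hP g₀ os).vol ∧
          (∀ (K : ℕ) (t : ℝ), |t| ≤ (cr F θ hP g₀ os).l₀ →
            T4GenFunBounds.schemeZ ((datumOfRecord₁₃CoPH F 2 θ hP).scheme g₀) os ((cr F θ hP g₀ os).K₀ + K) t =
              ∑ τ ∈ (cr F θ hP g₀ os).T K, (cr F θ hP g₀ os).A K t τ) ∧
          (∀ (K : ℕ) (t : ℝ), |t| ≤ (cr F θ hP g₀ os).l₀ →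
            T4GenFunBounds.schemeZ ((datumOfRecord₁₃CoPH F 2 θ hP).scheme g₀) os ((cr F θ hP g₀ os).K₀ + K + 1) t =
              ∑ τ ∈ (cr F θ hP g₀ os).T K, (cr F θ hP g₀ os).B K t τ)) :
    SpineGivenEndpointR13SepCoPH :=
  fun F θ hP hG hθ _ _ => keyedGuarded₁₃CoPH_of_keyedFacesP cr rr (fun θ => θ.ZhUnity _ 2 ∧ θ.SlotsNondegenerate₁₃ _ 2) P h20
    (shellWeightBound_guarded₁₃CoPH_of_dilationLevels cr (fun F θ => θ.ZhUnity F 2 ∧ θ.SlotsNondegenerate₁₃ F 2) h21dil) hrates h19 hx F θ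
    hP.toCore hG hθ

/-- ★★ **K3⁷ FROM THE KEYED CORE, THE N21 FACE FROM THE DILATION ROAD** (`N = 2`): leaf D `spineGivenEndpointR13SepCoPH_of_keyedCore` — N20 at `cr`,
the UNCONDITIONAL same-tuple ∃δ-core edge, the keyed extraction clause — with `h21` REPLACED by the dilation package with domination.  NOT a
discharge. [bookkeeping] -/
theorem spineGivenEndpointR13SepCoPH_of_keyedCore_dilationLevels
    (h20 : ∀ (F : T4Family) (θ : Stage13HParams F 2) (hP : θ.Provisos₁₃CoPH F 2), (θ.ZhUnity F 2 ∧ θ.SlotsNondegenerate₁₃ F 2) → θ.Admissible F 2 → ∀ (g₀ : ℕ → ℝ) (os : List (ULoop F)),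
      RelWeightBound (cr F θ hP g₀ os).l₀ (cr F θ hP g₀ os).T (cr F θ hP g₀ os).A (cr F θ hP g₀ os).B (cr F θ hP g₀ os).Bad (cr F θ hP g₀ os).W)
    (h21dil : ∀ (F : T4Family) (θ : Stage13HParams F 2) (hP : θ.Provisos₁₃CoPH F 2), (θ.ZhUnity F 2 ∧ θ.SlotsNondegenerate₁₃ F 2) → θ.Admissible F 2 →
      ∀ (g₀ : ℕ → ℝ) (os : List (ULoop F)), letI S := cr F θ hP g₀ os
      Summable S.Wsh ∧
      ∃ (σA σB : Type) (SA : ℕ → Finset σA) (SB : ℕ → Finset σB) (pieceA : ℕ → ℝ → σA → S.ι → ℝ)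
        (pieceB : ℕ → ℝ → σB → S.ι → ℝ) (lvlA : ℕ → σA → ℕ) (lvlB : ℕ → σB → ℕ) (MA dA ρA MB dB ρB : ℕ → ℝ)
        (N₁ : ℕ) (νbar Mbar d₀ c₁ ϑ : ℝ) (p q : ℕ),
        LevelLedger S.l₀ S.T S.A S.shA SA pieceA lvlA (fun j => MA j * (3 * (dA j + 1) / (1 - ρA j))) ρA ∧
        LevelLedger S.l₀ S.T S.B S.shB SB pieceB lvlB (fun j => MB j * (3 * (dB j + 1) / (1 - ρB j))) ρB ∧
        LiveWindow SA lvlA N₁ νbar ∧ LiveWindow SB lvlB N₁ νbar ∧ 0 ≤ ϑ ∧ ϑ < 1 ∧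
        (∀ j, 0 ≤ MA j) ∧ (∀ j, MA j ≤ Mbar * ((j : ℝ) ^ q + 1)) ∧ (∀ j, 0 ≤ MB j) ∧ (∀ j, MB j ≤ Mbar * ((j : ℝ) ^ q + 1)) ∧
        (∀ j, 0 ≤ dA j) ∧ (∀ j, dA j ≤ d₀ * ((j : ℝ) ^ p + 1)) ∧ (∀ j, 0 ≤ dB j) ∧ (∀ j, dB j ≤ d₀ * ((j : ℝ) ^ p + 1)) ∧
        (∀ j, ρA j ≤ 1 / 2) ∧ (∀ j, ρA j ≤ c₁ * ϑ ^ j) ∧ (∀ j, ρB j ≤ 1 / 2) ∧ (∀ j, ρB j ≤ c₁ * ϑ ^ j) ∧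
        (∀ K, ∑ s ∈ SA K, (MA (lvlA K s) * (3 * (dA (lvlA K s) + 1) / (1 - ρA (lvlA K s)))) * ρA (lvlA K s) +
          ∑ s ∈ SB K, (MB (lvlB K s) * (3 * (dB (lvlB K s) + 1) / (1 - ρB (lvlB K s)))) * ρB (lvlB K s) ≤ S.Wsh K))
    (hcore : ∀ (F : T4Family) (θ : Stage13HParams F 2) (hP : θ.Provisos₁₃CoPH F 2), (θ.ZhUnity F 2 ∧ θ.SlotsNondegenerate₁₃ F 2) → θ.Admissible F 2 → ∀ (g₀ : ℕ → ℝ) (os : List (ULoop F)),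
      letI := (cr F θ hP g₀ os).dec
      ∃ δ : ℕ → ℝ, NE7.Core (cr F θ hP g₀ os).l₀ (cr F θ hP g₀ os).vol (cr F θ hP g₀ os).T (cr F θ hP g₀ os).Bad
        (fun K t τ => (cr F θ hP g₀ os).A K t τ - (cr F θ hP g₀ os).shA K t τ) (fun K t τ => (cr F θ hP g₀ os).B K t τ - (cr F θ hP g₀ os).shB K t τ) δ ∧
        Summable δ)
    (hx : ∀ (F : T4Family) (θ : Stage13HParams F 2) (hP : θ.Provisos₁₃CoPH F 2), (θ.ZhUnity F 2 ∧ θ.SlotsNondegenerate₁₃ F 2) → θ.Admissible F 2 →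
      B16.EndStatementBPrinted (datumOfRecord₁₃CoPH F 2 θ hP).C → DagBinding.EndpointExistence (datumOfRecord₁₃CoPH F 2 θ hP).C.toB12 →
        ForSmallCouplings (datumOfRecord₁₃CoPH F 2 θ hP) fun g₀ => ∀ os : List (ULoop F),
          0 < (cr F θ hP g₀ os).l₀ ∧ 0 < (cr F θ hP g₀ os).vol ∧
          (∀ (K : ℕ) (t : ℝ), |t| ≤ (cr F θ hP g₀ os).l₀ →
            T4GenFunBounds.schemeZ ((datumOfRecord₁₃CoPH F 2 θ hP).scheme g₀) os ((cr F θ hP g₀ os).K₀ + K) t =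
              ∑ τ ∈ (cr F θ hP g₀ os).T K, (cr F θ hP g₀ os).A K t τ) ∧
          (∀ (K : ℕ) (t : ℝ), |t| ≤ (cr F θ hP g₀ os).l₀ →
            T4GenFunBounds.schemeZ ((datumOfRecord₁₃CoPH F 2 θ hP).scheme g₀) os ((cr F θ hP g₀ os).K₀ + K + 1) t =
              ∑ τ ∈ (cr F θ hP g₀ os).T K, (cr F θ hP g₀ os).B K t τ)) :
    SpineGivenEndpointR13SepCoPH :=
  fun F θ hP hG hθ _ _ => keyedGuarded₁₃CoPH_of_keyedCore cr (fun θ => θ.ZhUnity _ 2 ∧ θ.SlotsNondegenerate₁₃ _ 2) h20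
    (shellWeightBound_guarded₁₃CoPH_of_dilationLevels cr (fun F θ => θ.ZhUnity F 2 ∧ θ.SlotsNondegenerate₁₃ F 2) h21dil) hcore hx F θ
    hP.toCore hG hθ

/-- ★★ **K3⁷ IN THE PLAN's R-β CURRENCY, BUNDLED, THE N21 FACE FROM THE DILATION ROAD** (`N = 2`): leaf D
`spineGivenEndpointR13SepCoPH_of_keyedFacesRatesHolder` (K4's six β-rates `RatesHolderAt (datumOfRecord₁₃CoPH F 2 θ h) (rr …) β`, dag-n16-e 41ᴴ, the N19′ edge
reading them, N20, extraction) with `h21` REPLACED by the dilation package with domination — the K3⁷ skeleton v2's concluder shape with its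
`KeyedShellWeight` conjunct fed by road II.  NOT a discharge; NE3 at exponent β NOT PROVED. [bookkeeping] -/
theorem spineGivenEndpointR13SepCoPH_of_keyedFacesRatesHolder_dilationLevels
    (h20 : ∀ (F : T4Family) (θ : Stage13HParams F 2) (hP : θ.Provisos₁₃CoPH F 2), (θ.ZhUnity F 2 ∧ θ.SlotsNondegenerate₁₃ F 2) → θ.Admissible F 2 → ∀ (g₀ : ℕ → ℝ) (os : List (ULoop F)),
      RelWeightBound (cr F θ hP g₀ os).l₀ (cr F θ hP g₀ os).T (cr F θ hP g₀ os).A (cr F θ hP g₀ os).B (cr F θ hP g₀ os).Bad (cr F θ hP g₀ os).W)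
    (h21dil : ∀ (F : T4Family) (θ : Stage13HParams F 2) (hP : θ.Provisos₁₃CoPH F 2), (θ.ZhUnity F 2 ∧ θ.SlotsNondegenerate₁₃ F 2) → θ.Admissible F 2 →
      ∀ (g₀ : ℕ → ℝ) (os : List (ULoop F)), letI S := cr F θ hP g₀ os
      Summable S.Wsh ∧
      ∃ (σA σB : Type) (SA : ℕ → Finset σA) (SB : ℕ → Finset σB) (pieceA : ℕ → ℝ → σA → S.ι → ℝ)
        (pieceB : ℕ → ℝ → σB → S.ι → ℝ) (lvlA : ℕ → σA → ℕ) (lvlB : ℕ → σB → ℕ) (MA dA ρA MB dB ρB : ℕ → ℝ)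
        (N₁ : ℕ) (νbar Mbar d₀ c₁ ϑ : ℝ) (p q : ℕ),
        LevelLedger S.l₀ S.T S.A S.shA SA pieceA lvlA (fun j => MA j * (3 * (dA j + 1) / (1 - ρA j))) ρA ∧
        LevelLedger S.l₀ S.T S.B S.shB SB pieceB lvlB (fun j => MB j * (3 * (dB j + 1) / (1 - ρB j))) ρB ∧
        LiveWindow SA lvlA N₁ νbar ∧ LiveWindow SB lvlB N₁ νbar ∧ 0 ≤ ϑ ∧ ϑ < 1 ∧
        (∀ j, 0 ≤ MA j) ∧ (∀ j, MA j ≤ Mbar * ((j : ℝ) ^ q + 1)) ∧ (∀ j, 0 ≤ MB j) ∧ (∀ j, MB j ≤ Mbar * ((j : ℝ) ^ q + 1)) ∧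
        (∀ j, 0 ≤ dA j) ∧ (∀ j, dA j ≤ d₀ * ((j : ℝ) ^ p + 1)) ∧ (∀ j, 0 ≤ dB j) ∧ (∀ j, dB j ≤ d₀ * ((j : ℝ) ^ p + 1)) ∧
        (∀ j, ρA j ≤ 1 / 2) ∧ (∀ j, ρA j ≤ c₁ * ϑ ^ j) ∧ (∀ j, ρB j ≤ 1 / 2) ∧ (∀ j, ρB j ≤ c₁ * ϑ ^ j) ∧
        (∀ K, ∑ s ∈ SA K, (MA (lvlA K s) * (3 * (dA (lvlA K s) + 1) / (1 - ρA (lvlA K s)))) * ρA (lvlA K s) +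
          ∑ s ∈ SB K, (MB (lvlB K s) * (3 * (dB (lvlB K s) + 1) / (1 - ρB (lvlB K s)))) * ρB (lvlB K s) ≤ S.Wsh K))
    (hrates : ∀ (F : T4Family) (θ : Stage13HParams F 2) (hP : θ.Provisos₁₃CoPH F 2), (θ.ZhUnity F 2 ∧ θ.SlotsNondegenerate₁₃ F 2) → θ.Admissible F 2 → ∀ (g₀ : ℕ → ℝ) (os : List (ULoop F)),
      RatesHolderAt (datumOfRecord₁₃CoPH F 2 θ hP) (rr F θ hP g₀ os) β)
    (h19 : ∀ (F : T4Family) (θ : Stage13HParams F 2) (hP : θ.Provisos₁₃CoPH F 2), (θ.ZhUnity F 2 ∧ θ.SlotsNondegenerate₁₃ F 2) → θ.Admissible F 2 → ∀ (g₀ : ℕ → ℝ) (os : List (ULoop F)),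
      RatesHolderAt (datumOfRecord₁₃CoPH F 2 θ hP) (rr F θ hP g₀ os) β → letI := (cr F θ hP g₀ os).dec
        ∃ δ : ℕ → ℝ, NE7.Core (cr F θ hP g₀ os).l₀ (cr F θ hP g₀ os).vol (cr F θ hP g₀ os).T (cr F θ hP g₀ os).Bad
          (fun K t τ => (cr F θ hP g₀ os).A K t τ - (cr F θ hP g₀ os).shA K t τ) (fun K t τ => (cr F θ hP g₀ os).B K t τ - (cr F θ hP g₀ os).shB K t τ) δ ∧
          Summable δ)
    (hx : ∀ (F : T4Family) (θ : Stage13HParams F 2) (hP : θ.Provisos₁₃CoPH F 2), (θ.ZhUnity F 2 ∧ θ.SlotsNondegenerate₁₃ F 2) → θ.Admissible F 2 →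
      B16.EndStatementBPrinted (datumOfRecord₁₃CoPH F 2 θ hP).C → DagBinding.EndpointExistence (datumOfRecord₁₃CoPH F 2 θ hP).C.toB12 →
        ForSmallCouplings (datumOfRecord₁₃CoPH F 2 θ hP) fun g₀ => ∀ os : List (ULoop F),
          0 < (cr F θ hP g₀ os).l₀ ∧ 0 < (cr F θ hP g₀ os).vol ∧
          (∀ (K : ℕ) (t : ℝ), |t| ≤ (cr F θ hP g₀ os).l₀ →
            T4GenFunBounds.schemeZ ((datumOfRecord₁₃CoPH F 2 θ hP).scheme g₀) os ((cr F θ hP g₀ os).K₀ + K) t =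
              ∑ τ ∈ (cr F θ hP g₀ os).T K, (cr F θ hP g₀ os).A K t τ) ∧
          (∀ (K : ℕ) (t : ℝ), |t| ≤ (cr F θ hP g₀ os).l₀ →
            T4GenFunBounds.schemeZ ((datumOfRecord₁₃CoPH F 2 θ hP).scheme g₀) os ((cr F θ hP g₀ os).K₀ + K + 1) t =
              ∑ τ ∈ (cr F θ hP g₀ os).T K, (cr F θ hP g₀ os).B K t τ)) :
    SpineGivenEndpointR13SepCoPH :=
  fun F θ hP hG hθ _ _ => keyedGuarded₁₃CoPH_of_keyedFacesRatesHolder cr rr (fun θ => θ.ZhUnity _ 2 ∧ θ.SlotsNondegenerate₁₃ _ 2) β h20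
    (shellWeightBound_guarded₁₃CoPH_of_dilationLevels cr (fun F θ => θ.ZhUnity F 2 ∧ θ.SlotsNondegenerate₁₃ F 2) h21dil) hrates h19 hx F θ
    hP.toCore hG hθ

end Summit.QuantumFields.YangMills.Theorems.N21DilationRoadAtRecord13CoPH
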